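import Literature.NumberTheory.Transcendental.BakerQuantSetup
import Literature.NumberTheory.Transcendental.CijsouwWaldschmidt1977Delta
import HarnessLib

/-!
# Cijsouw–Waldschmidt 1977 over `ℚ` (`p = 2`): the set-up and the auxiliary functions

Support file (plain definitions and theorems; no named fact) for the proof of Cijsouw–Waldschmidt
1977, Proposition 1 for `K = ℚ`, `p = 2`, `β₀ = 0` — the archimedean input of
`Literature.Barriers.ABC.BakerMethodBounds` (`BakerMethodBoundsKummerArchSymmProofs.lean`).

The data (`CW77.Setup`): `d` "free" positive rationals `α₁, …, α_d` and one more positive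
rational `θ` (Cijsouw–Waldschmidt's `αₙ`, the logarithm with coefficient `−1`), integers
`b₁, …, b_d` and `b_θ ≠ 0`; `βⱼ = −bⱼ/b_θ`, `Λ₀ = ∑ βⱼ log αⱼ − log θ = −Λ/b_θ` for the linear form
`Λ = ∑ bⱼ log αⱼ + b_θ log θ`.

The auxiliary functions of §4 (pp. 184–188) at the level `J` of the `2`-descent, for a multi-index
`τ = (τ₀, τ')` (`τ₀` derivatives in the `Δ`-variable, `τ'ⱼ` in the variable of `αⱼ`):
`f_{J,τ}(z) = ∑_u p(u) · (d/dz)^{τ₀}[w_u(2^{J₀−J} z)] · ∏ⱼ γⱼ^{τ'ⱼ} · e^{z ∑ⱼ γⱼ log αⱼ}` and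
`φ_{J,τ}(z)` = the same with `e^{z(∑ⱼ λⱼ log αⱼ + λ_θ log θ)}`, where `u = (ρ, λ, λ_θ)`,
`γⱼ = λⱼ + λ_θ βⱼ`, `w_ρ = Δ(X; r) Δ(X; h)ˡ` is Baker's triangular family (`BakerQuantDelta.wPoly`,
`ρ = (r, l)`), and `∑ γⱼ log αⱼ = ∑ λⱼ log αⱼ + λ_θ log θ + λ_θ Λ₀` (the homogeneous case of
"Remark that the exponent is equal to `(λₙΛ₀ + λ₁ log α₁ + ⋯ + λₙ log αₙ) z`", p. 184). The
`Δ`-factor is taken on the finest lattice `2^{-J₀}ℤ` of the descent (`w_u(2^{J₀−J} X)`), so that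
all later evaluation points are natural numbers (see `CW77Delta.lean`).

Proved here (in the style of `BakerQuantSetup.lean`, whose Leibniz polynomial `Qw` is reused):
the derivative identity `f'_{J,τ} = f_{J,τ+e₀} + ∑ⱼ lⱼ f_{J,τ+eⱼ}` (`hasDerivAt_F`; the
differential equations of p. 188), the control of derivatives by values (`norm_iteratedDeriv_F_le_of_forall`),
and Lemma 9 in abstract form (`norm_F_sub_Φ_le`: `|f − φ| ≤ (∑|terms of φ|) · x e^x`,
`x ≥ |λ_θ Λ₀ z|`, from `|e^w − 1| ≤ |w| e^{|w|}`).

## References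

* [CijsouwWaldschmidt1977] P. L. Cijsouw, M. Waldschmidt, *Linear forms and simultaneous
  approximations*, Compositio Math. 34 (1977), 173–197 — §4, pp. 184–188 (the functions `F`,
  `F_(τ)`, `Φ_(τ)`, `f_{J,(τ)}`, `φ_{J,(τ)}`, Lemma 9, the differential equations).
-/

noncomputable section

open Complex Finset Polynomial
open Literature.NumberTheory.Transcendental.Baker1975
open Literature.NumberTheory.Transcendental.Baker1975.Ch3

namespace Literature.NumberTheory.Transcendental.CW77

/-! ### The data -/

/-- **The data of Proposition 1 over `ℚ` (homogeneous case)**: `d` free positive rationals `αⱼ`,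
the eliminated positive rational `θ`, and the integer coefficients `bⱼ`, `b_θ ≠ 0` of the linear
form `Λ = ∑ bⱼ log αⱼ + b_θ log θ`. [cite: CijsouwWaldschmidt1977, Prop 1 (p. 183)] -/
structure Setup where
  /-- the number of free generators -/
  d : ℕ
  /-- the free generators -/
  α : Fin d → ℚ
  /-- the eliminated generator -/
  θ : ℚ
  /-- positivity -/
  α_pos : ∀ j, 0 < α j
  /-- positivity -/
  θ_pos : 0 < θ
  /-- the coefficients of the free logarithms -/
  b : Fin d → ℤ
  /-- the coefficient of `log θ` -/
  bθ : ℤ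
  /-- it is non-zero -/
  bθ_ne : bθ ≠ 0

namespace Setup

variable (S : Setup)

/-- `lⱼ = log αⱼ` (real). [cite: CijsouwWaldschmidt1977, §4] -/
def l (j : Fin S.d) : ℝ := Real.log (S.α j)

/-- `l_θ = log θ`. [cite: CijsouwWaldschmidt1977, §4] -/
def lθ : ℝ := Real.log S.θ

/-- `βⱼ = −bⱼ / b_θ`. [cite: CijsouwWaldschmidt1977, Prop 1 (p. 183)] -/
def β (j : Fin S.d) : ℚ := -(S.b j : ℚ) / S.bθ

/-- `Λ₀ = ∑ βⱼ log αⱼ − log θ`. [cite: CijsouwWaldschmidt1977, Prop 1 (p. 183)] -/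
def Λ₀ : ℝ := ∑ j, (S.β j : ℝ) * S.l j - S.lθ

/-- The linear form `Λ = ∑ bⱼ log αⱼ + b_θ log θ`. [cite: CijsouwWaldschmidt1977, Theorem 1] -/
def Λ : ℝ := ∑ j, (S.b j : ℝ) * S.l j + (S.bθ : ℝ) * S.lθ

/-- `Λ = −b_θ Λ₀`. [folklore] -/
theorem Λ_eq : S.Λ = -(S.bθ : ℝ) * S.Λ₀ := by
  have hb : (S.bθ : ℝ) ≠ 0 := by exact_mod_cast S.bθ_ne
  unfold Λ Λ₀ β
  rw [mul_sub, Finset.mul_sum]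
  have : ∀ j, -(S.bθ : ℝ) * ((((-(S.b j : ℚ) / S.bθ : ℚ)) : ℝ) * S.l j) = (S.b j : ℝ) * S.l j := by
    intro j; push_cast; field_simp
  simp_rw [this]; ring

/-- `|Λ₀| ≤ |Λ|` (as `|b_θ| ≥ 1`). [folklore] -/
theorem abs_Λ₀_le : |S.Λ₀| ≤ |S.Λ| := by
  rw [S.Λ_eq, abs_mul, abs_neg]
  have : (1 : ℝ) ≤ |(S.bθ : ℝ)| := by exact_mod_cast Int.one_le_abs S.bθ_ne
  exact le_mul_of_one_le_left (abs_nonneg _) this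

/-! ### Indices and boxes -/

/-- The index of one unknown: `u = (ρ, λ, λ_θ)` with `ρ = (r, l)` the `Δ`-polynomial
`Δ(X;r)Δ(X;h)ˡ` (`r < h`, `l < Lb`), `λ : Fin d → ℕ` the exponents of the `αⱼ`, `λ_θ` that of `θ`.
[cite: CijsouwWaldschmidt1977, §4 (p. 184)] -/
abbrev Idx (d h Lb : ℕ) : Type := (Fin h × Fin Lb) × ((Fin d → ℕ) × ℕ)

/-- A derivative multi-index `τ = (τ₀, τ')`. [cite: CijsouwWaldschmidt1977, §4 (p. 185)] -/
abbrev Tau (d : ℕ) : Type := ℕ × (Fin d → ℕ)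

/-- `|τ| = τ₀ + ∑ τ'ⱼ`. [cite: CijsouwWaldschmidt1977, §4 (p. 185)] -/
def tauNorm {d : ℕ} (τ : Tau d) : ℕ := τ.1 + ∑ j, τ.2 j

/-- `τ + e₀`. [folklore] -/
def bump0 {d : ℕ} (τ : Tau d) : Tau d := (τ.1 + 1, τ.2)

/-- `τ + eⱼ`. [folklore] -/
def bumpj {d : ℕ} (τ : Tau d) (j : Fin d) : Tau d := (τ.1, bump τ.2 j)

/-- `|τ + e₀| = |τ| + 1`. [folklore] -/
theorem tauNorm_bump0 {d : ℕ} (τ : Tau d) : tauNorm (bump0 τ) = tauNorm τ + 1 := by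
  unfold tauNorm bump0; simp; ring

/-- `|τ + eⱼ| = |τ| + 1`. [folklore] -/
theorem tauNorm_bumpj {d : ℕ} (τ : Tau d) (j : Fin d) : tauNorm (bumpj τ j) = tauNorm τ + 1 := by
  unfold tauNorm bumpj; simp only; rw [sum_bump]; ring

/-- `τ + eᵢ` for `i : Fin (d+1)`: `i = 0` is the `Δ`-direction, `i = j+1` the direction of `αⱼ`. [folklore] -/
def bumpτ {d : ℕ} (τ : Tau d) (i : Fin (d + 1)) : Tau d := Fin.cases (bump0 τ) (fun j => bumpj τ j) i

/-- `τ + e₀` is the bump of `τ₀`. [folklore] -/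
@[simp] theorem bumpτ_zero {d : ℕ} (τ : Tau d) : bumpτ τ 0 = bump0 τ := rfl

/-- `τ + e_{j+1}` is the bump of `τ'ⱼ`. [folklore] -/
@[simp] theorem bumpτ_succ {d : ℕ} (τ : Tau d) (j : Fin d) : bumpτ τ j.succ = bumpj τ j := rfl

/-- `|τ + eᵢ| = |τ| + 1`. [folklore] -/
theorem tauNorm_bumpτ {d : ℕ} (τ : Tau d) (i : Fin (d + 1)) : tauNorm (bumpτ τ i) = tauNorm τ + 1 := by
  refine Fin.cases ?_ (fun j => ?_) i
  · rw [bumpτ_zero, tauNorm_bump0]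
  · rw [bumpτ_succ, tauNorm_bumpj]

variable {h Lb : ℕ}

/-- `γⱼ(u) = λⱼ + λ_θ βⱼ` (rational). [cite: CijsouwWaldschmidt1977, §4 (p. 184)] -/
def γ (u : Idx S.d h Lb) (j : Fin S.d) : ℚ := (u.2.1 j : ℚ) + (u.2.2 : ℚ) * S.β j

/-- The exact exponent `ψ_u = ∑ λⱼ lⱼ + λ_θ l_θ` (of `φ`). [cite: CijsouwWaldschmidt1977, §4 (p. 185)] -/
def ψ (u : Idx S.d h Lb) : ℝ := ∑ j, (u.2.1 j : ℝ) * S.l j + (u.2.2 : ℝ) * S.lθ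

/-- The perturbed exponent `∑ γⱼ lⱼ = ψ_u + λ_θ Λ₀` (of `f`). [cite: CijsouwWaldschmidt1977, §4 (p. 184)] -/
def expo (u : Idx S.d h Lb) : ℝ := S.ψ u + (u.2.2 : ℝ) * S.Λ₀

/-- **The identity behind `f`**: `∑ⱼ γⱼ lⱼ = ψ_u + λ_θ Λ₀`. [cite: CijsouwWaldschmidt1977, §4 (p. 184)] -/
theorem expo_eq (u : Idx S.d h Lb) : S.expo u = ∑ j, (S.γ u j : ℝ) * S.l j := by
  unfold expo ψ Λ₀ γ
  push_cast
  simp only [add_mul, sum_add_distrib, mul_sum, mul_sub]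
  ring_nf

/-- `A(u, τ') = ∏ⱼ γⱼ^{τ'ⱼ}`, the polynomial factor produced by the derivatives in the variables of
the `αⱼ` (Cijsouw–Waldschmidt's `𝓛_(τ)` without its `Δ`-part; the powers of `log αⱼ` are kept OUT of
the functions, as in "`f_{J,(τ)}(z) = (log α₁)^{−τ₁}⋯(log αₙ₋₁)^{−τₙ₋₁} ∑ …`", p. 188).
[cite: CijsouwWaldschmidt1977, §4 (pp. 185, 188)] -/
def A (u : Idx S.d h Lb) (τ' : Fin S.d → ℕ) : ℂ := ∏ j, (S.γ u j : ℂ) ^ τ' j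

/-- The `Δ`-polynomial of `u` at level `J` of the descent with finest level `J₀`:
`w_ρ(2^{J₀−J} X)`, `w_ρ = Δ(X;r)Δ(X;h)ˡ`. [cite: CijsouwWaldschmidt1977, §4 (p. 186)] -/
def wOf (J₀ J : ℕ) (u : Idx S.d h Lb) : ℂ[X] :=
  (wPoly (u.1.1 : ℕ) (u.1.2 : ℕ) h).comp (C ((2 ^ (J₀ - J) : ℕ) : ℂ) * X)

/-- One term of `f_{J,τ}`: `(d/dz)^{τ₀}[w_ρ(2^{J₀−J}z)] · A(u,τ') · e^{(ψ_u + λ_θΛ₀) z}`.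
[cite: CijsouwWaldschmidt1977, §4 (p. 186)] -/
def termF (J₀ J : ℕ) (u : Idx S.d h Lb) (τ : Tau S.d) (z : ℂ) : ℂ :=
  Qw τ.1 (S.wOf J₀ J u) 0 z * S.A u τ.2 * cexp ((S.expo u : ℂ) * z)

/-- One term of `φ_{J,τ}`: the same with the exact exponent `ψ_u`. [cite: CijsouwWaldschmidt1977, §4 (p. 186)] -/
def termΦ (J₀ J : ℕ) (u : Idx S.d h Lb) (τ : Tau S.d) (z : ℂ) : ℂ :=
  Qw τ.1 (S.wOf J₀ J u) 0 z * S.A u τ.2 * cexp ((S.ψ u : ℂ) * z)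

/-- **`f_{J,τ}(z) = ∑_{u ∈ box} p(u) · termF`**. [cite: CijsouwWaldschmidt1977, §4 (p. 186)] -/
def F (J₀ J : ℕ) (box : Finset (Idx S.d h Lb)) (p : Idx S.d h Lb → ℤ) (τ : Tau S.d) (z : ℂ) : ℂ :=
  ∑ u ∈ box, (p u : ℂ) * S.termF J₀ J u τ z

/-- **`φ_{J,τ}(z) = ∑_{u ∈ box} p(u) · termΦ`**. [cite: CijsouwWaldschmidt1977, §4 (p. 186)] -/
def Φ (J₀ J : ℕ) (box : Finset (Idx S.d h Lb)) (p : Idx S.d h Lb → ℤ) (τ : Tau S.d) (z : ℂ) : ℂ :=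
  ∑ u ∈ box, (p u : ℂ) * S.termΦ J₀ J u τ z

/-! ### The derivative of `f_{J,τ}` -/

/-- `Qw m w 0 z = w^{(m)}(z)`. [folklore] -/
theorem Qw_zero_right (m : ℕ) (w : ℂ[X]) (z : ℂ) : Qw m w 0 z = (derivative^[m] w).eval z := by
  unfold Qw
  rw [Finset.sum_range_succ, Nat.choose_self, Nat.sub_self, pow_zero]
  rw [Finset.sum_eq_zero]
  · simp
  · intro μ hμ
    have : m - μ ≠ 0 := by have := mem_range.mp hμ; omega
    rw [zero_pow this]; ring

/-- `A(u, τ' + eⱼ) = A(u, τ') · γⱼ`. [folklore] -/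
theorem A_bump (u : Idx S.d h Lb) (τ' : Fin S.d → ℕ) (j : Fin S.d) :
    S.A u (bump τ' j) = S.A u τ' * (S.γ u j : ℂ) := by
  unfold A
  have hj : ∀ j' : Fin S.d, (S.γ u j' : ℂ) ^ bump τ' j j' =
      (S.γ u j' : ℂ) ^ τ' j' * (if j' = j then (S.γ u j : ℂ) else 1) := by
    intro j'
    rw [bump_apply, pow_add]
    congr 1
    by_cases hjj : j' = j
    · subst hjj; simp
    · rw [if_neg hjj, if_neg hjj, pow_zero]
  simp_rw [hj]
  rw [prod_mul_distrib, prod_ite_eq' univ j, if_pos (mem_univ j)]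

/-- **The derivative of one term**: `d/dz termF_τ = termF_{τ+e₀} + ∑ⱼ lⱼ · termF_{τ+eⱼ}`.
[cite: CijsouwWaldschmidt1977, §4 (p. 188), the differential equations] -/
theorem hasDerivAt_termF (J₀ J : ℕ) (u : Idx S.d h Lb) (τ : Tau S.d) (z : ℂ) :
    HasDerivAt (S.termF J₀ J u τ)
      (S.termF J₀ J u (bump0 τ) z + ∑ j : Fin S.d, (S.l j : ℂ) * S.termF J₀ J u (bumpj τ j) z) z := by
  set c : ℂ := ∑ j, (S.γ u j : ℂ) * (S.l j : ℂ) with hc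
  have hce : (S.expo u : ℂ) = c := by
    rw [S.expo_eq u, hc]; push_cast; rfl
  have hsplit : S.termF J₀ J u τ = fun x => (Qw τ.1 (S.wOf J₀ J u) 0 x * cexp (0 * x)) *
      (S.A u τ.2 * cexp (c * x)) := by
    funext x; simp only [termF, hce, zero_mul, Complex.exp_zero, mul_one]; ring
  rw [hsplit]
  have h1 := hasDerivAt_Qw_mul_cexp τ.1 (S.wOf J₀ J u) 0 z
  have h2 : HasDerivAt (fun x => S.A u τ.2 * cexp (c * x)) (S.A u τ.2 * (cexp (c * z) * c)) z := by
    have : HasDerivAt (fun x => cexp (c * x)) (cexp (c * z) * c) z := by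
      have h := ((hasDerivAt_id z).const_mul c).cexp
      simpa using h
    exact this.const_mul _
  refine (h1.fun_mul h2).congr_deriv ?_
  have e0 : S.termF J₀ J u (bump0 τ) z = Qw (τ.1 + 1) (S.wOf J₀ J u) 0 z * cexp (0 * z) *
      (S.A u τ.2 * cexp (c * z)) := by
    simp only [termF, bump0, hce, zero_mul, Complex.exp_zero, mul_one]; ring
  have er : ∀ j : Fin S.d, (S.l j : ℂ) * S.termF J₀ J u (bumpj τ j) z =
      Qw τ.1 (S.wOf J₀ J u) 0 z * cexp (0 * z) * (S.A u τ.2 * cexp (c * z)) *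
        ((S.γ u j : ℂ) * (S.l j : ℂ)) := by
    intro j
    simp only [termF, bumpj, hce, zero_mul, Complex.exp_zero, mul_one]
    rw [S.A_bump]
    ring
  rw [e0]
  simp_rw [er]
  rw [← mul_sum]
  ring

/-- The coefficients of the differential equation: `1` in the `Δ`-direction, `lⱼ` in the direction of
`αⱼ`. [cite: CijsouwWaldschmidt1977, §4 (p. 188)] -/
def dcoef (i : Fin (S.d + 1)) : ℂ := Fin.cases (1 : ℂ) (fun j => (S.l j : ℂ)) i

/-- `dcoef 0 = 1`. [folklore] -/
@[simp] theorem dcoef_zero : S.dcoef 0 = 1 := rfl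

/-- `dcoef (j+1) = lⱼ`. [folklore] -/
@[simp] theorem dcoef_succ (j : Fin S.d) : S.dcoef j.succ = (S.l j : ℂ) := rfl

/-- `∑ᵢ |dcoef i| = 1 + ∑ⱼ |lⱼ|`. [folklore] -/
theorem sum_norm_dcoef : ∑ i, ‖S.dcoef i‖ = 1 + ∑ j, |S.l j| := by
  rw [Fin.sum_univ_succ, dcoef_zero, norm_one]
  simp only [dcoef_succ, Complex.norm_real, Real.norm_eq_abs]

/-- **`d/dz f_{J,τ} = ∑ᵢ cᵢ f_{J,τ+eᵢ}`** (`= f_{J,τ+e₀} + ∑ⱼ lⱼ f_{J,τ+eⱼ}`; the differential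
equations of p. 188). [cite: CijsouwWaldschmidt1977, §4 (p. 188)] -/
theorem hasDerivAt_F (J₀ J : ℕ) (box : Finset (Idx S.d h Lb)) (p : Idx S.d h Lb → ℤ)
    (τ : Tau S.d) (z : ℂ) :
    HasDerivAt (S.F J₀ J box p τ) (∑ i : Fin (S.d + 1), S.dcoef i * S.F J₀ J box p (bumpτ τ i) z) z := by
  have hsum : HasDerivAt (S.F J₀ J box p τ) (∑ u ∈ box, (p u : ℂ) *
      (S.termF J₀ J u (bump0 τ) z + ∑ j : Fin S.d, (S.l j : ℂ) * S.termF J₀ J u (bumpj τ j) z)) z := by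
    unfold F
    exact HasDerivAt.fun_sum fun u _ => (S.hasDerivAt_termF J₀ J u τ z).const_mul _
  refine hsum.congr_deriv ?_
  rw [Fin.sum_univ_succ]
  simp only [F, bumpτ_zero, bumpτ_succ, dcoef_zero, dcoef_succ, one_mul, mul_add, sum_add_distrib, mul_sum]
  congr 1
  rw [sum_comm]
  exact sum_congr rfl fun j _ => sum_congr rfl fun u _ => by ring

/-- `f_{J,τ}` is entire. [folklore] -/
theorem differentiable_F (J₀ J : ℕ) (box : Finset (Idx S.d h Lb)) (p : Idx S.d h Lb → ℤ)
    (τ : Tau S.d) : Differentiable ℂ (S.F J₀ J box p τ) :=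
  fun z => (S.hasDerivAt_F J₀ J box p τ z).differentiableAt

/-- `deriv f_{J,τ} = ∑ᵢ cᵢ f_{J,τ+eᵢ}`. [cite: CijsouwWaldschmidt1977, §4 (p. 188)] -/
theorem deriv_F (J₀ J : ℕ) (box : Finset (Idx S.d h Lb)) (p : Idx S.d h Lb → ℤ) (τ : Tau S.d) :
    deriv (S.F J₀ J box p τ) = fun z => ∑ i : Fin (S.d + 1), S.dcoef i * S.F J₀ J box p (bumpτ τ i) z :=
  funext fun z => (S.hasDerivAt_F J₀ J box p τ z).deriv

/-- **Derivatives are controlled by values** ((10) ⇒ (11), pp. 188–189): if `|f_{J,τ'}(r)| ≤ ε`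
whenever `|τ'| ≤ N`, then `|f_{J,τ}^{(k)}(r)| ≤ (1 + ∑ⱼ|lⱼ|)^k ε` whenever `|τ| + k ≤ N`.
[cite: CijsouwWaldschmidt1977, §4 (11) (p. 189)] -/
theorem norm_iteratedDeriv_F_le_of_forall (J₀ J : ℕ) (box : Finset (Idx S.d h Lb))
    (p : Idx S.d h Lb → ℤ) (r : ℂ) (N : ℕ) {ε : ℝ}
    (hε : ∀ τ : Tau S.d, tauNorm τ ≤ N → ‖S.F J₀ J box p τ r‖ ≤ ε) :
    ∀ (k : ℕ) (τ : Tau S.d), tauNorm τ + k ≤ N →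
      ‖iteratedDeriv k (S.F J₀ J box p τ) r‖ ≤ (1 + ∑ j, |S.l j|) ^ k * ε := by
  intro k
  induction k with
  | zero => intro τ hτ; simpa using hε τ (by simpa using hτ)
  | succ k ih =>
    intro τ hτ
    have hcd : ∀ i ∈ (univ : Finset (Fin (S.d + 1))),
        ContDiffAt ℂ k (fun z => S.dcoef i * S.F J₀ J box p (bumpτ τ i) z) r := fun i _ =>
      (((S.differentiable_F J₀ J box p _).const_mul _).contDiff).contDiffAt
    rw [iteratedDeriv_succ', S.deriv_F J₀ J box p τ, iteratedDeriv_fun_sum hcd]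
    have hci : ∀ i : Fin (S.d + 1), iteratedDeriv k (fun z => S.dcoef i * S.F J₀ J box p (bumpτ τ i) z) r =
        S.dcoef i * iteratedDeriv k (S.F J₀ J box p (bumpτ τ i)) r := fun i =>
      iteratedDeriv_const_mul _ ((S.differentiable_F J₀ J box p _).contDiff).contDiffAt
    simp_rw [hci]
    calc ‖∑ i, S.dcoef i * iteratedDeriv k (S.F J₀ J box p (bumpτ τ i)) r‖
        ≤ ∑ i, ‖S.dcoef i * iteratedDeriv k (S.F J₀ J box p (bumpτ τ i)) r‖ := norm_sum_le _ _
      _ ≤ ∑ i : Fin (S.d + 1), ‖S.dcoef i‖ * ((1 + ∑ j, |S.l j|) ^ k * ε) := by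
          refine sum_le_sum fun i _ => ?_
          rw [norm_mul]
          refine mul_le_mul_of_nonneg_left (ih _ ?_) (norm_nonneg _)
          rw [tauNorm_bumpτ]; omega
      _ = (1 + ∑ j, |S.l j|) ^ (k + 1) * ε := by
          rw [← sum_mul, sum_norm_dcoef, pow_succ]; ring

/-! ### Sizes of the terms, and Lemma 9 -/

/-- `|e^{wz}| = e^{Re(wz)} ≤ e^{|w| |z|}` for real `w`. [folklore] -/
theorem norm_cexp_ofReal_mul_le (w : ℝ) (z : ℂ) : ‖cexp ((w : ℂ) * z)‖ ≤ Real.exp (|w| * ‖z‖) := by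
  rw [Complex.norm_exp]
  apply Real.exp_le_exp.mpr
  calc ((w : ℂ) * z).re ≤ ‖(w : ℂ) * z‖ := Complex.re_le_norm _
    _ = |w| * ‖z‖ := by rw [norm_mul, Complex.norm_real, Real.norm_eq_abs]

/-- **Size of one term of `φ`**: `|termΦ| ≤ Q · G_A · e^{Ψ|z|}` from bounds `Q ≥ |Qw|`,
`G_A ≥ |A|`, `Ψ ≥ |ψ_u|`. [cite: CijsouwWaldschmidt1977, §4 Lemma 9 (p. 187)] -/
theorem norm_termΦ_le (J₀ J : ℕ) (u : Idx S.d h Lb) (τ : Tau S.d) (z : ℂ) {Q GA Ψ : ℝ}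
    (hQ : ‖Qw τ.1 (S.wOf J₀ J u) 0 z‖ ≤ Q) (hA : ‖S.A u τ.2‖ ≤ GA) (hψ : |S.ψ u| ≤ Ψ) :
    ‖S.termΦ J₀ J u τ z‖ ≤ Q * GA * Real.exp (Ψ * ‖z‖) := by
  unfold termΦ
  rw [norm_mul, norm_mul]
  have hQ0 : 0 ≤ Q := (norm_nonneg _).trans hQ
  have hGA0 : 0 ≤ GA := (norm_nonneg _).trans hA
  have h3 : ‖cexp ((S.ψ u : ℂ) * z)‖ ≤ Real.exp (Ψ * ‖z‖) :=
    (norm_cexp_ofReal_mul_le _ z).trans (Real.exp_le_exp.mpr (mul_le_mul_of_nonneg_right hψ (norm_nonneg _)))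
  exact mul_le_mul (mul_le_mul hQ hA (norm_nonneg _) hQ0) h3 (norm_nonneg _) (mul_nonneg hQ0 hGA0)

/-- **Size of one term of `f`**: `|termF| ≤ Q · G_A · e^{Ψ'|z|}`, `Ψ' ≥ |ψ_u + λ_θ Λ₀|`.
[cite: CijsouwWaldschmidt1977, §4 (p. 189)] -/
theorem norm_termF_le (J₀ J : ℕ) (u : Idx S.d h Lb) (τ : Tau S.d) (z : ℂ) {Q GA Ψ : ℝ}
    (hQ : ‖Qw τ.1 (S.wOf J₀ J u) 0 z‖ ≤ Q) (hA : ‖S.A u τ.2‖ ≤ GA) (hψ : |S.expo u| ≤ Ψ) :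
    ‖S.termF J₀ J u τ z‖ ≤ Q * GA * Real.exp (Ψ * ‖z‖) := by
  unfold termF
  rw [norm_mul, norm_mul]
  have hQ0 : 0 ≤ Q := (norm_nonneg _).trans hQ
  have hGA0 : 0 ≤ GA := (norm_nonneg _).trans hA
  have h3 : ‖cexp ((S.expo u : ℂ) * z)‖ ≤ Real.exp (Ψ * ‖z‖) :=
    (norm_cexp_ofReal_mul_le _ z).trans (Real.exp_le_exp.mpr (mul_le_mul_of_nonneg_right hψ (norm_nonneg _)))
  exact mul_le_mul (mul_le_mul hQ hA (norm_nonneg _) hQ0) h3 (norm_nonneg _) (mul_nonneg hQ0 hGA0)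

/-- **Size of `φ_{J,τ}`**: `|φ_{J,τ}(z)| ≤ #box · P · Q · G_A · e^{Ψ|z|}`.
[cite: CijsouwWaldschmidt1977, §4 Lemma 9 (p. 187)] -/
theorem norm_Φ_le (J₀ J : ℕ) (box : Finset (Idx S.d h Lb)) (p : Idx S.d h Lb → ℤ) (τ : Tau S.d)
    (z : ℂ) {P Q GA Ψ : ℝ} (hp : ∀ u ∈ box, |(p u : ℝ)| ≤ P)
    (hQ : ∀ u ∈ box, ‖Qw τ.1 (S.wOf J₀ J u) 0 z‖ ≤ Q) (hA : ∀ u ∈ box, ‖S.A u τ.2‖ ≤ GA)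
    (hψ : ∀ u ∈ box, |S.ψ u| ≤ Ψ) :
    ‖S.Φ J₀ J box p τ z‖ ≤ box.card * P * (Q * GA * Real.exp (Ψ * ‖z‖)) := by
  unfold Φ
  calc ‖∑ u ∈ box, (p u : ℂ) * S.termΦ J₀ J u τ z‖ ≤ ∑ u ∈ box, ‖(p u : ℂ) * S.termΦ J₀ J u τ z‖ :=
        norm_sum_le _ _
    _ ≤ ∑ _u ∈ box, P * (Q * GA * Real.exp (Ψ * ‖z‖)) := by
        refine sum_le_sum fun u hu => ?_
        rw [norm_mul]
        have h1 : ‖(p u : ℂ)‖ ≤ P := by rw [Complex.norm_intCast]; exact hp u hu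
        exact mul_le_mul h1 (S.norm_termΦ_le J₀ J u τ z (hQ u hu) (hA u hu) (hψ u hu))
          (norm_nonneg _) ((abs_nonneg _).trans (hp u hu))
    _ = box.card * P * (Q * GA * Real.exp (Ψ * ‖z‖)) := by rw [sum_const, nsmul_eq_mul]; ring

/-- **Size of `f_{J,τ}`** (`|f_{J,(τ)}|_R < exp(c₁₄ν^{2n+3}U)`, p. 189):
`|f_{J,τ}(z)| ≤ #box · P · Q · G_A · e^{Ψ'|z|}`. [cite: CijsouwWaldschmidt1977, §4 (p. 189)] -/
theorem norm_F_le (J₀ J : ℕ) (box : Finset (Idx S.d h Lb)) (p : Idx S.d h Lb → ℤ) (τ : Tau S.d)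
    (z : ℂ) {P Q GA Ψ : ℝ} (hp : ∀ u ∈ box, |(p u : ℝ)| ≤ P)
    (hQ : ∀ u ∈ box, ‖Qw τ.1 (S.wOf J₀ J u) 0 z‖ ≤ Q) (hA : ∀ u ∈ box, ‖S.A u τ.2‖ ≤ GA)
    (hψ : ∀ u ∈ box, |S.expo u| ≤ Ψ) :
    ‖S.F J₀ J box p τ z‖ ≤ box.card * P * (Q * GA * Real.exp (Ψ * ‖z‖)) := by
  unfold F
  calc ‖∑ u ∈ box, (p u : ℂ) * S.termF J₀ J u τ z‖ ≤ ∑ u ∈ box, ‖(p u : ℂ) * S.termF J₀ J u τ z‖ :=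
        norm_sum_le _ _
    _ ≤ ∑ _u ∈ box, P * (Q * GA * Real.exp (Ψ * ‖z‖)) := by
        refine sum_le_sum fun u hu => ?_
        rw [norm_mul]
        have h1 : ‖(p u : ℂ)‖ ≤ P := by rw [Complex.norm_intCast]; exact hp u hu
        exact mul_le_mul h1 (S.norm_termF_le J₀ J u τ z (hQ u hu) (hA u hu) (hψ u hu))
          (norm_nonneg _) ((abs_nonneg _).trans (hp u hu))
    _ = box.card * P * (Q * GA * Real.exp (Ψ * ‖z‖)) := by rw [sum_const, nsmul_eq_mul]; ring

/-- **Lemma 9** (the relation between `f` and `φ`, p. 187): on the box, where `λ_θ ≤ L_θ`, and for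
`|z|` with `L_θ |Λ₀| |z| ≤ x ≤ 1`,
`|f_{J,τ}(z) − φ_{J,τ}(z)| ≤ #box · P · Q · G_A · e^{Ψ|z|} · 2x` ("Clearly, we have by the
inequality `|e^w − 1| ≤ |w|e^{|w|}`, `|e^{λₙΛ₀z} − 1| ≤ Lₙ^{(J)} p^J S |Λ₀| e^{Lₙ^{(J)}p^JS|Λ₀|}`";
here with Mathlib's `|e^w − 1| ≤ 2|w|` for `|w| ≤ 1`).
[cite: CijsouwWaldschmidt1977, §4 Lemma 9 (p. 187)] -/
theorem norm_F_sub_Φ_le (J₀ J : ℕ) (box : Finset (Idx S.d h Lb)) (p : Idx S.d h Lb → ℤ)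
    (τ : Tau S.d) (z : ℂ) {P Q GA Ψ x : ℝ} {Lθ : ℕ} (hp : ∀ u ∈ box, |(p u : ℝ)| ≤ P)
    (hQ : ∀ u ∈ box, ‖Qw τ.1 (S.wOf J₀ J u) 0 z‖ ≤ Q) (hA : ∀ u ∈ box, ‖S.A u τ.2‖ ≤ GA)
    (hψ : ∀ u ∈ box, |S.ψ u| ≤ Ψ) (hLθ : ∀ u ∈ box, u.2.2 ≤ Lθ) (hx : (Lθ : ℝ) * |S.Λ₀| * ‖z‖ ≤ x)
    (hx1 : x ≤ 1) :
    ‖S.F J₀ J box p τ z - S.Φ J₀ J box p τ z‖ ≤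
      box.card * P * (Q * GA * Real.exp (Ψ * ‖z‖)) * (2 * x) := by
  have hdiff : S.F J₀ J box p τ z - S.Φ J₀ J box p τ z =
      ∑ u ∈ box, (p u : ℂ) * (S.termΦ J₀ J u τ z * (cexp (((u.2.2 : ℝ) * S.Λ₀ : ℝ) * z) - 1)) := by
    unfold F Φ
    rw [← sum_sub_distrib]
    refine sum_congr rfl fun u _ => ?_
    have : S.termF J₀ J u τ z = S.termΦ J₀ J u τ z * cexp (((u.2.2 : ℝ) * S.Λ₀ : ℝ) * z) := by
      unfold termF termΦ expo
      push_cast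
      rw [add_mul, Complex.exp_add]; ring
    rw [this]; ring
  rw [hdiff]
  have hx0 : 0 ≤ x := le_trans (by positivity) hx
  calc ‖∑ u ∈ box, (p u : ℂ) * (S.termΦ J₀ J u τ z * (cexp (((u.2.2 : ℝ) * S.Λ₀ : ℝ) * z) - 1))‖
      ≤ ∑ u ∈ box, ‖(p u : ℂ) * (S.termΦ J₀ J u τ z * (cexp (((u.2.2 : ℝ) * S.Λ₀ : ℝ) * z) - 1))‖ :=
        norm_sum_le _ _
    _ ≤ ∑ _u ∈ box, P * ((Q * GA * Real.exp (Ψ * ‖z‖)) * (2 * x)) := by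
        refine sum_le_sum fun u hu => ?_
        rw [norm_mul, norm_mul]
        have h1 : ‖(p u : ℂ)‖ ≤ P := by rw [Complex.norm_intCast]; exact hp u hu
        have h2 := S.norm_termΦ_le J₀ J u τ z (hQ u hu) (hA u hu) (hψ u hu)
        have hQGA : 0 ≤ Q * GA * Real.exp (Ψ * ‖z‖) :=
          mul_nonneg (mul_nonneg ((norm_nonneg _).trans (hQ u hu)) ((norm_nonneg _).trans (hA u hu)))
            (Real.exp_pos _).le
        have hw : ‖(((u.2.2 : ℝ) * S.Λ₀ : ℝ) : ℂ) * z‖ ≤ x := by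
          rw [norm_mul, Complex.norm_real, Real.norm_eq_abs, abs_mul, Nat.abs_cast]
          refine le_trans ?_ hx
          have : (u.2.2 : ℝ) ≤ Lθ := by exact_mod_cast hLθ u hu
          exact mul_le_mul_of_nonneg_right (mul_le_mul_of_nonneg_right this (abs_nonneg _)) (norm_nonneg _)
        have h3 : ‖cexp ((((u.2.2 : ℝ) * S.Λ₀ : ℝ) : ℂ) * z) - 1‖ ≤ 2 * x :=
          (Complex.norm_exp_sub_one_le (hw.trans hx1)).trans (by linarith)
        exact mul_le_mul h1 (mul_le_mul h2 h3 (norm_nonneg _) hQGA) (by positivity)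
          ((abs_nonneg _).trans (hp u hu))
    _ = box.card * P * (Q * GA * Real.exp (Ψ * ‖z‖)) * (2 * x) := by
        rw [sum_const, nsmul_eq_mul]; ring

/-! ### The values of `φ_{J,τ}` at natural numbers: the rational core -/

/-- The natural number `E(a,b,h,x,m)` with `ν(x,h)ᵐ ((1/m!)dᵐ w_{a,b})(x) = E` (Baker's Lemma 1).
[cite: BakerTNT1975, Ch. 3 §2 Lemma 1] -/
def hdNat {a b h' : ℕ} (hah : a ≤ h') (x m : ℕ) : ℕ :=
  Classical.choose (exists_nat_hasseDeriv_wPoly_eval (b := b) hah x m)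

/-- The defining property and the size of `hdNat`. [cite: BakerTNT1975, Ch. 3 §2 Lemma 1] -/
theorem hdNat_spec {a b h' : ℕ} (hah : a ≤ h') (x m : ℕ) :
    ((nuBound x h' : ℂ)) ^ m * (hasseDeriv m (wPoly a b h')).eval (x : ℂ) = (hdNat (b := b) hah x m : ℂ) ∧
      hdNat (b := b) hah x m ≤ 2 ^ (a + b * h') * nuBound x h' ^ m * ((x + a).choose a * (x + h').choose h' ^ b) :=
  Classical.choose_spec (exists_nat_hasseDeriv_wPoly_eval (b := b) hah x m)

/-- The scale `2^{J₀−J}` of the level `J`. [folklore] -/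
def scale (J₀ J : ℕ) : ℕ := 2 ^ (J₀ - J)

/-- `0 < 2^{J₀−J}`. [folklore] -/
theorem scale_pos (J₀ J : ℕ) : 0 < scale J₀ J := Nat.pow_pos two_pos

/-- **The rational value of the `Δ`-factor**: `Qw τ₀ (w_ρ(2^{J₀−J}X)) 0 s = qΔ ∈ ℚ`, namely
`qΔ = τ₀! · (2^{J₀−J})^{τ₀} · E / ν^{τ₀}` with `x = 2^{J₀−J}s`, `ν = ν(x,h)`, `E = hdNat`.
[cite: CijsouwWaldschmidt1977, §4 (9) (p. 184)] -/
def qΔ (J₀ J : ℕ) (u : Idx S.d h Lb) (τ₀ s : ℕ) : ℚ :=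
  (τ₀.factorial : ℚ) * ((scale J₀ J) ^ τ₀ : ℕ) *
    (hdNat (b := (u.1.2 : ℕ)) (le_of_lt u.1.1.isLt) (scale J₀ J * s) τ₀ : ℚ) /
      ((nuBound (scale J₀ J * s) h) ^ τ₀ : ℕ)

/-- **`Qw τ₀ (w_ρ(2^{J₀−J}X)) 0 s = qΔ`** at a natural number `s`. [cite: CijsouwWaldschmidt1977, §4 (9) (p. 184)] -/
theorem Qw_wOf_natCast (J₀ J : ℕ) (u : Idx S.d h Lb) (τ₀ s : ℕ) :
    Qw τ₀ (S.wOf J₀ J u) 0 (s : ℂ) = (S.qΔ J₀ J u τ₀ s : ℂ) := by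
  rw [Qw_zero_right, iterate_derivative_eval_eq_factorial_mul_hasseDeriv]
  unfold wOf qΔ scale
  rw [hasseDeriv_comp_C_mul_X_eval]
  have hspec := (hdNat_spec (b := (u.1.2 : ℕ)) (le_of_lt u.1.1.isLt) (2 ^ (J₀ - J) * s) τ₀).1
  have hν : ((nuBound (2 ^ (J₀ - J) * s) h : ℂ)) ^ τ₀ ≠ 0 :=
    pow_ne_zero _ (by exact_mod_cast (nuBound_pos _ _).ne')
  have hH : (hasseDeriv τ₀ (wPoly (u.1.1 : ℕ) (u.1.2 : ℕ) h)).eval (((2 ^ (J₀ - J) : ℕ) : ℂ) * (s : ℂ)) =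
      (hdNat (b := (u.1.2 : ℕ)) (le_of_lt u.1.1.isLt) (2 ^ (J₀ - J) * s) τ₀ : ℂ) /
        ((nuBound (2 ^ (J₀ - J) * s) h : ℂ)) ^ τ₀ := by
    rw [eq_div_iff hν, mul_comm, ← hspec]; push_cast; ring
  rw [hH]
  push_cast
  ring

/-- `qA(u, τ') = ∏ⱼ γⱼ^{τ'ⱼ}` (rational). [cite: CijsouwWaldschmidt1977, §4 (p. 185)] -/
def qA (u : Idx S.d h Lb) (τ' : Fin S.d → ℕ) : ℚ := ∏ j, (S.γ u j) ^ τ' j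

/-- `A(u, τ') = qA` (cast). [folklore] -/
theorem A_eq (u : Idx S.d h Lb) (τ' : Fin S.d → ℕ) : S.A u τ' = (S.qA u τ' : ℂ) := by
  unfold A qA; push_cast; rfl

/-- `qE(u, s) = ∏ⱼ αⱼ^{λⱼ s} · θ^{λ_θ s}` (rational). [cite: CijsouwWaldschmidt1977, §4 (p. 186)] -/
def qE (u : Idx S.d h Lb) (s : ℕ) : ℚ := (∏ j, (S.α j) ^ (u.2.1 j * s)) * S.θ ^ (u.2.2 * s)

/-- `e^{ψ_u s} = qE(u, s)` at a natural number `s`. [folklore] -/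
theorem cexp_ψ_natCast (u : Idx S.d h Lb) (s : ℕ) : cexp ((S.ψ u : ℂ) * (s : ℂ)) = (S.qE u s : ℂ) := by
  unfold ψ qE l lθ
  have hα : ∀ j, Real.exp (Real.log (S.α j : ℝ)) = (S.α j : ℝ) := fun j =>
    Real.exp_log (by exact_mod_cast S.α_pos j)
  have hθ : Real.exp (Real.log (S.θ : ℝ)) = (S.θ : ℝ) := Real.exp_log (by exact_mod_cast S.θ_pos)
  push_cast
  rw [add_mul, Complex.exp_add, sum_mul, Complex.exp_sum]
  congr 1
  · refine prod_congr rfl fun j _ => ?_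
    rw [show ((u.2.1 j : ℕ) : ℂ) * (Real.log (S.α j : ℝ) : ℂ) * (s : ℂ) =
        ((u.2.1 j * s : ℕ) : ℂ) * (Real.log (S.α j : ℝ) : ℂ) by push_cast; ring,
      Complex.exp_nat_mul, ← Complex.ofReal_exp, hα]
    push_cast; rfl
  · rw [show ((u.2.2 : ℕ) : ℂ) * (Real.log (S.θ : ℝ) : ℂ) * (s : ℂ) =
        ((u.2.2 * s : ℕ) : ℂ) * (Real.log (S.θ : ℝ) : ℂ) by push_cast; ring,
      Complex.exp_nat_mul, ← Complex.ofReal_exp, hθ]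
    push_cast; rfl

/-- The rational core of one term at a natural point: `qΔ · qA · qE`. [cite: CijsouwWaldschmidt1977, §4 (p. 186)] -/
def qTerm (J₀ J : ℕ) (u : Idx S.d h Lb) (τ : Tau S.d) (s : ℕ) : ℚ :=
  S.qΔ J₀ J u τ.1 s * S.qA u τ.2 * S.qE u s

/-- **The rational core of `φ_{J,τ}(s)`**: `coreSum = ∑_u p(u) · qΔ qA qE`. [cite: CijsouwWaldschmidt1977, §4 (p. 186)] -/
def coreSum (J₀ J : ℕ) (box : Finset (Idx S.d h Lb)) (p : Idx S.d h Lb → ℤ) (τ : Tau S.d) (s : ℕ) : ℚ :=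
  ∑ u ∈ box, (p u : ℚ) * S.qTerm J₀ J u τ s

/-- **`φ_{J,τ}(s) = coreSum`** at a natural number `s` (a rational number). [cite: CijsouwWaldschmidt1977, §4 (p. 188)] -/
theorem Φ_natCast (J₀ J : ℕ) (box : Finset (Idx S.d h Lb)) (p : Idx S.d h Lb → ℤ) (τ : Tau S.d) (s : ℕ) :
    S.Φ J₀ J box p τ (s : ℂ) = (S.coreSum J₀ J box p τ s : ℂ) := by
  unfold Φ coreSum
  push_cast
  refine sum_congr rfl fun u _ => ?_
  unfold termΦ qTerm
  rw [S.Qw_wOf_natCast, S.A_eq, S.cexp_ψ_natCast]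
  push_cast; ring

/-- **`φ_{J,τ}(s) = 0 ⟺ coreSum = 0`.** [folklore] -/
theorem Φ_natCast_eq_zero_iff (J₀ J : ℕ) (box : Finset (Idx S.d h Lb))
    (p : Idx S.d h Lb → ℤ) (τ : Tau S.d) (s : ℕ) :
    S.Φ J₀ J box p τ (s : ℂ) = 0 ↔ S.coreSum J₀ J box p τ s = 0 := by
  rw [S.Φ_natCast]; exact_mod_cast Iff.rfl

end Setup

end Literature.NumberTheory.Transcendental.CW77
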